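import Literature.NumberTheory.GaloisRepresentations.RestrictedRamificationSUnitsLayerInjectivityTwo
import Literature.NumberTheory.GaloisRepresentations.RestrictedRamificationSUnitsLayerSupplyTwo
import Literature.NumberTheory.GaloisRepresentations.IdeleSUnitsCohomologyDegreeTwo
import HarnessLib

/-!
# LOCAL INVARIANTS DETECT `S`-UNIT CLASSES UP TO A DEEPER LAYER: two classes of `H²(Gal(E/F₀), 𝒪ˣ_{E,S})` with the same
# local invariants at the places above `S` become equal in a bigger layer of `K_S` (the one-layer counting step behind
# `#H²(G_S, 𝒪_S^×)[p^k] ≤ p^{k·#S}`, Neukirch–Schmidt–Wingberg (8.3.11) (ii)/(iii))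

Topic `NumberTheory/GaloisRepresentations`; namespaces `Literature.NumberTheory.GaloisRepresentations.IdeleCohomology` (§1, one
tower of number fields) and `Literature.NumberTheory.GaloisRepresentations` (§2, layers of `K_S`).  THEOREMS ONLY (no definition,
no named fact, no `sorry`, no instance).  Lane «TATE-EPC-TC» of cell `bsd-eis` (crux `GoodLatticeBDPValue`,
stmt-BirchSwinnertonDyer-19032; brick B6a, layer half, (F2e)): the layer input of the UPPER BOUND on the `p`-power torsion of
`H²(G_S, 𝒪_S^×) = lim→ H²(Gal(E/F₀), 𝒪ˣ_{E,S})` by the number of invariant families (the colimit bookkeeping (F2b) is not done here).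

MATHEMATICS (Tate, C–F VII §7.3 Prop. 7.3; NSW VIII §3, proof of (8.3.11)).  `F` totally complex, `E/F` finite Galois unramified
outside the finite set `S` of finite places, `G = Gal(E/F)`.  A class of `H²(G, J_{E,S})` is determined by its local invariants at
the places of `S` (its invariants off `S` and at infinity vanish; Tate's Prop. 7.3 — the tree's `eq_zero_of_forall_mem_localInv_eq_zero`).
Hence two `S`-unit classes `x, y ∈ H²(G, 𝒪ˣ_{E,S})` whose images in `H²(G, J_E)` have the same invariants at the places of `S` have
`ι_*(x − y) = 0` in `H²(G, J_{E,S})`, and by the INJECTIVITY SUPPLY (`RestrictedRamificationSUnitsLayerInjectivityTwo`: capitulation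
kills such classes) `Inf x = Inf y` in `H²(Gal(E'/F), 𝒪ˣ_{E',S})` for every layer `E' ⊇ E` in which the idèles of `E` capitulate.
§2: over `K_S` (`K` totally complex, `F₀ ≤ E ⊆ K_S`, `S₀` the places of `F₀` above `S`, the `S`-unit model `SUnits.sUnitsRep K S F₀ E`
read in `H²(Gal(E/F₀), J_E)` through this seat's `sUnitsToIdeleS` and `ideleSRepHom`), two classes with the same invariants at the
places of `S₀` have the same `layerInf` at some finite Galois layer `E′ ⊇ E` of `K_S`.

* §1 **`IdeleCohomology.sUnitsIdeleInf_two_eq_of_forall_localInv_eq`** (one tower with capitulation).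
* §2 **`exists_layerInf_eq_of_forall_localInv_eq`** (over `K_S`, `SUnits.Layers.layerInf` currency).

HONEST FRAMING: finite-layer statements only (no colimit, no `G_S`-module, no `Nat.card`); proves neither (8.3.11) for `G_S` nor any
statement of a Summit; no case of BSD is advanced by this file alone; 0 cells / labels / tiers move.

## References
* J. W. S. Cassels, A. Fröhlich (eds.), *Algebraic Number Theory* (1967), Ch. VII (J. Tate) §7.3 Prop. 7.3, Cor. 7.4 (b).
  [CasselsFrohlichANT1967]
* J. Neukirch, A. Schmidt, K. Wingberg, *Cohomology of Number Fields*, 2nd ed. (2008), VIII §3, (8.3.11) (ii)/(iii) and its proof.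
  [NeukirchSchmidtWingberg2008]
* D. Harari, *Galois Cohomology and Class Field Theory*, Universitext, Springer (2020), §13.1 Prop. 13.1 (b), §17.4 (17.1). [Harari2020]
-/

noncomputable section

open NumberField IsDedekindDomain Field IntermediateField CategoryTheory groupCohomology
open Literature.NumberTheory.GaloisRepresentations.OpenSubgroupLayer (algOfLE isScalarTower_algOfLE)
open Literature.NumberTheory.GaloisRepresentations.LocalWeilDatum
open Literature.NumberTheory.Automorphic

namespace Literature.NumberTheory.GaloisRepresentations

namespace IdeleCohomology

/-! ## §1. One tower `F ⊆ E ⊆ E'` over a totally complex base -/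

section Tower

variable {F E E' : Type} [Field F] [NumberField F] [Field E] [NumberField E] [Field E'] [NumberField E']
  [Algebra F E] [Algebra E E'] [Algebra F E'] [IsScalarTower F E E'] [IsTotallyComplex F] [IsGalois F E]
variable (S : Finset (HeightOneSpectrum (𝓞 F)))

/-- **Local invariants detect `S`-unit classes up to a capitulating layer.**  `F` totally complex, `F ⊆ E ⊆ E'`, `E/F` Galois and
unramified outside the finite set `S` of finite places; assume CAPITULATION: the base change of every idèle of `E` lies in
`E'ˣ · J_{E',S}`.  If `x, y ∈ H²(Gal(E/F), 𝒪ˣ_{E,S})` (principal `S`-idèle model) have images in `H²(Gal(E/F), J_E)` with the same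
local invariant at every place of `S`, then `Inf x = Inf y` in `H²(Gal(E'/F), 𝒪ˣ_{E',S})`: `ι_*(x − y) ∈ H²(G, J_{E,S})` has all its
`S`-invariants zero, hence vanishes (Tate's Prop. 7.3, `eq_zero_of_forall_mem_localInv_eq_zero`), and the injectivity supply
(`sUnitsIdeleInf_two_eq_zero_of_map_eq_zero`) kills `x − y` upstairs.
[cite: CasselsFrohlichANT1967, Ch. VII §7.3 Prop. 7.3][cite: NeukirchSchmidtWingberg2008, VIII §3 (8.3.11) (ii)/(iii) (proof)] -/
theorem sUnitsIdeleInf_two_eq_of_forall_localInv_eq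
    (hS : ∀ v : HeightOneSpectrum (𝓞 F), v ∉ S → Algebra.IsUnramifiedIn (𝓞 E) v.asIdeal)
    (hcap : ∀ a : ideleGroup E, AdeleRing.ideleBaseChange E E' a ∈ principalIdeles E' ⊔ ideleS F E' S)
    (x y : groupCohomology (sUnitsIdeleRep F E S) 2)
    (h : ∀ v ∈ S,
      localInv E v (groupCohomology.map (MonoidHom.id (E ≃ₐ[F] E)) (sUnitsIdeleι S ≫ ideleSRepHom S) 2 x) =
        localInv E v (groupCohomology.map (MonoidHom.id (E ≃ₐ[F] E)) (sUnitsIdeleι S ≫ ideleSRepHom S) 2 y)) :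
    sUnitsIdeleInf F E E' S 2 x = sUnitsIdeleInf F E E' S 2 y := by
  rw [← sub_eq_zero, ← map_sub]
  apply sUnitsIdeleInf_two_eq_zero_of_map_eq_zero S hcap
  -- `ι_*(x − y)` has all its `S`-invariants zero
  apply eq_zero_of_forall_mem_localInv_eq_zero S hS
  intro v hv
  have hxy := h v hv
  rw [groupCohomology.map_id_comp] at hxy
  simp only [ModuleCat.hom_comp, LinearMap.coe_comp, Function.comp_apply] at hxy
  rw [map_sub, map_sub, map_sub, hxy, sub_self]

end Tower

end IdeleCohomology

/-! ## §2. Over `K_S`: equal invariants ⟹ equal `layerInf` at some deeper layer -/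

variable {K : Type} [Field K] [NumberField K] (S : Set (HeightOneSpectrum (𝓞 K)))

/-- **Local invariants detect `S`-unit classes up to a deeper layer of `K_S`.**  `K` totally complex, `S` a set of finite places of `K`,
`F₀ ≤ E ⊆ K_S` with `E/K` finite Galois, `S₀` the finite set of places of `F₀` above `S`.  If `c, c' ∈ H²(Gal(E/F₀), 𝒪ˣ_{E,S})` (the model
`SUnits.sUnitsRep K S F₀ E`, read in `H²(Gal(E/F₀), J_E)` through `sUnitsToIdeleS ≫ ideleSRepHom`) have the same local invariant at
every place of `S₀`, then `Inf c = Inf c'` in `H²(Gal(E′/F₀), 𝒪ˣ_{E′,S})` for some finite Galois layer `E′ ⊇ E` inside `K_S` (all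
algebras = inclusions): `c − c'` dies in `H²(Gal(E/F₀), J_{E,S₀})` (Tate's Prop. 7.3 over the totally complex `F₀`; `E/F₀` is
unramified outside `S₀`), then `exists_layerInf_two_eq_zero_of_map_sUnitsToIdeleS_eq_zero`.
[cite: CasselsFrohlichANT1967, Ch. VII §7.3 Prop. 7.3][cite: NeukirchSchmidtWingberg2008, VIII §3 (8.3.11) (ii)/(iii) (proof)] -/
theorem exists_layerInf_eq_of_forall_localInv_eq [IsTotallyComplex K]
    {F₀ E : IntermediateField K (AlgebraicClosure K)} [FiniteDimensional K E] [IsGalois K E] (hF : F₀ ≤ E)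
    (hS : ramificationSubgroup K S ≤ galFixing K E)
    (S₀ : Finset (HeightOneSpectrum (𝓞 F₀))) (hSF : ∀ u : HeightOneSpectrum (𝓞 F₀), u ∈ S₀ ↔ u.under (𝓞 K) ∈ S)
    (c c' : letI := algOfLE hF; groupCohomology (SUnits.sUnitsRep K S F₀ E) 2)
    (h : letI := algOfLE hF
      haveI : FiniteDimensional K F₀ :=
        FiniteDimensional.of_injective (IntermediateField.inclusion hF).toLinearMap (IntermediateField.inclusion hF).injective
      haveI : NumberField F₀ := NumberField.of_module_finite K F₀
      haveI : NumberField E := NumberField.of_module_finite K E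
      haveI := isScalarTower_algOfLE (K := K) hF
      haveI : IsGalois F₀ E := IsGalois.tower_top_of_isGalois K F₀ E
      ∀ v ∈ S₀,
        IdeleCohomology.localInv E v
            (groupCohomology.map (MonoidHom.id (E ≃ₐ[F₀] E)) (A := SUnits.sUnitsRep K S F₀ E)
              (B := IdeleClassGroup.ideleRep F₀ E)
              (IdeleCohomology.sUnitsToIdeleS (K := K) (F := F₀) (E := E) S S₀ hSF ≫ IdeleCohomology.ideleSRepHom S₀) 2 c) =
          IdeleCohomology.localInv E v
            (groupCohomology.map (MonoidHom.id (E ≃ₐ[F₀] E)) (A := SUnits.sUnitsRep K S F₀ E)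
              (B := IdeleClassGroup.ideleRep F₀ E)
              (IdeleCohomology.sUnitsToIdeleS (K := K) (F := F₀) (E := E) S S₀ hSF ≫ IdeleCohomology.ideleSRepHom S₀) 2 c')) :
    ∃ (E' : IntermediateField K (AlgebraicClosure K)) (_ : FiniteDimensional K E') (_ : IsGalois K E') (hEE' : E ≤ E')
      (_ : ramificationSubgroup K S ≤ galFixing K E'),
      SUnits.Layers.layerInf S hF hEE' 2 c = SUnits.Layers.layerInf S hF hEE' 2 c' := by
  -- the base `F₀`: finite over `K`, a totally complex number field; `E/F₀` Galois, unramified outside `S₀`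
  letI := algOfLE hF
  haveI := isScalarTower_algOfLE (K := K) hF
  haveI : FiniteDimensional K F₀ :=
    FiniteDimensional.of_injective (IntermediateField.inclusion hF).toLinearMap (IntermediateField.inclusion hF).injective
  haveI : NumberField F₀ := NumberField.of_module_finite K F₀
  haveI : NumberField E := NumberField.of_module_finite K E
  haveI : IsGalois F₀ E := IsGalois.tower_top_of_isGalois K F₀ E
  haveI : IsTotallyComplex F₀ := isTotallyComplex_of_algebra K F₀
  have hunr : ∀ v : HeightOneSpectrum (𝓞 F₀), v ∉ S₀ → Algebra.IsUnramifiedIn (𝓞 E) v.asIdeal :=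
    fun v hv => isUnramifiedIn_of_le_of_ramificationSubgroup_le_galFixing S hF hS v fun h' => hv ((hSF v).2 h')
  -- `c − c'` dies in `H²(Gal(E/F₀), J_{E,S₀})`: all its `S₀`-invariants vanish
  have hd : groupCohomology.map (MonoidHom.id (E ≃ₐ[F₀] E)) (A := SUnits.sUnitsRep K S F₀ E)
      (B := IdeleCohomology.ideleSRep F₀ E S₀) (IdeleCohomology.sUnitsToIdeleS (K := K) (F := F₀) (E := E) S S₀ hSF) 2
        (c - c') = 0 := by
    apply IdeleCohomology.eq_zero_of_forall_mem_localInv_eq_zero S₀ hunr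
    intro v hv
    have hv' := h v hv
    rw [groupCohomology.map_id_comp] at hv'
    simp only [ModuleCat.hom_comp, LinearMap.coe_comp, Function.comp_apply] at hv'
    rw [map_sub, map_sub, map_sub, sub_eq_zero]
    -- (statement-inlined instances vs. local ones: close by congruence)
    convert hv' using 5
  -- the injectivity supply over `K_S`
  obtain ⟨E', hfin', hgal', hEE', hS', h0⟩ :=
    exists_layerInf_two_eq_zero_of_map_sUnitsToIdeleS_eq_zero S hF hS S₀ hSF (c - c') hd
  refine ⟨E', hfin', hgal', hEE', hS', ?_⟩
  rw [map_sub, sub_eq_zero] at h0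
  convert h0 using 2

end Literature.NumberTheory.GaloisRepresentations

end
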